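import Summits.BirchSwinnertonDyer.Rank1Residual.Additive.RamifiedOrdinaryLineUniqueModelFree
import Summits.BirchSwinnertonDyer.Rank1Residual.X2.GreenbergVatsalTateDatumTorsion
import HarnessLib

/-!
# The scalars of a local inertia element on a ramified ordinary line, modulo `p`: line scalar `a`,
# quotient scalar `b`, `bⁿ ≡ 1` (clause 4) and `a·b ≡ χ_p(σ)` (Weil pairing) — MODEL-FREE tools

HONEST FRAMING (BSD rank-`≤ 1` residual cell `b2b-bsdres`, home
`run/shared/lean/b2b/bsd-rank1-residual/`, lane CLASS-CLOSURE, seat cc-typer-2 = typer of record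
N10 §3.2 / O7 §3.3, team n1011; typer-lane sequel S3 of S1 = `RamifiedOrdinaryLineUniqueModelFree`,
tool half; the matching theorem is the sibling `RamifiedOrdinaryLineMatchingModelFree`): the cell
deletes COMBINATION-SHAPED residual classes of the rank-`≤ 1` BSD formula from PUBLISHED theorems only
and TYPES the construction-shaped ones; research route, no claim beyond stated classes; census output =
EVIDENCE; nothing is booked by this file; no RESIDUAL-MAP mark moves. Theorems only: NO definition,
NO named fact, NO conjecture node.

WHAT. For a ramified ordinary line `C = L.plus ⊂ E[p^∞]` at `v ∋ p` (EPW §3.1 read on the curve,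
`IsRamifiedOrdinaryLine`; so `#(C ∩ E[p^∞][p]) = p` and `#(E[p^∞]/C)[p] = p`) and an element `τ` of
the local Galois group: `res τ` acts on `C[p]` as a natural scalar `a` (§1 `exists_lineScalar`) and on
`E[p^∞][p]` modulo `C` as a natural scalar `b` (§1 `exists_quotGenerator`, `exists_quotScalar`); if
`(res τ)ⁿ` is trivial on `E[p^∞]/C` then `bⁿ = 1` in `ℤ/p` (§2 `quotScalar_pow_eq_one`); and
`b·a = χ_p(τ)` in `ℤ/p` by the Weil pairing on `E` itself (`det ρ̄_{E,p} = ω`, the tree's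
`WeierstrassCurve.localPoints_exists_isPrimitiveRoot_smul_eq_pow` at level `1`, §2); finally a local
inertia element with `χ_p` a PRIMITIVE ROOT mod `p` exists (local Kronecker–Weber, §3), and the
arithmetic separation lemma `lineScalar_ne_quotScalar` (off the swap locus `(p − 1) ∣ lcm(n, n₁)`,
`a ≠ b₁`). No twist model, no class hypothesis, no reduction type; every `p`.

References: Greenberg–Vatsal, Invent. Math. 142 (2000) §2 pp. 14, 26 [GreenbergVatsal2000]; Silverman
*AEC* III.8.1 [SilvermanAEC2009]; Serre, *Local Fields* IV §4 Prop. 17 [SerreLocalFields1979];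
Emerton–Pollack–Weston (2006) §3.1 [EmertonPollackWeston2006].
-/

noncomputable section

open scoped Classical AddSubgroup

open NumberField IsDedekindDomain Field
  Literature.NumberTheory.GaloisRepresentations
  Literature.NumberTheory.EllipticCurves
  Literature.NumberTheory.EllipticCurves.GreenbergSelmer
  Literature.NumberTheory.EllipticCurves.EmertonPollackWeston2006
  IsDedekindDomain.HeightOneSpectrum
  Summit.BirchSwinnertonDyer.Rank1Residual.X2
  Summit.BirchSwinnertonDyer.Rank1Residual.X2.GreenbergVatsalReductionDatum
  Summit.BirchSwinnertonDyer.Rank1Residual.X2.GreenbergVatsalTateDatumCofree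
  Summit.BirchSwinnertonDyer.Rank1Residual.X2.GreenbergVatsalTateDatumTorsion
  Summit.BirchSwinnertonDyer.Rank1Residual.X2.TrivialZeroCorankAlgebra
  Summit.BirchSwinnertonDyer.Rank1Residual.Additive.RamifiedOrdinaryLineUnique
  Summit.BirchSwinnertonDyer.Rank1Residual.Additive.RamifiedOrdinaryLineUniqueModelFree
  Summit.BirchSwinnertonDyer.Rank1Residual.AdditivePotMult.RamifiedLineUnique
open WeierstrassCurve (geomTorsion geomPrimaryTorsion geomTorsion_le_geomPrimaryTorsion)

universe u

namespace Summit.BirchSwinnertonDyer.Rank1Residual.Additive.RamifiedOrdinaryLineInertiaScalars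


variable {W W₁ : WeierstrassCurve ℚ} [W.IsElliptic] [W₁.IsElliptic] {p : ℕ} [hp : Fact p.Prime]
  {v : HeightOneSpectrum (𝓞 ℚ)}

/-! ## §1. The scalars of a Galois element on the line `C[p]` and on `E[p]` modulo `C` -/

/-- **The line scalar.** For a ramified ordinary line `C = L.plus` (so `#(C ∩ E[p^∞][p]) = p`) and any
`τ ∈ Γ_{ℚ_v}`: `res τ` acts on `C ∩ E[p^∞][p]` as a natural scalar `a` (an automorphism of a group of
prime order). [cite: GreenbergVatsal2000, §2 p. 26] -/
theorem exists_lineScalar {L : LocalDatum ℚ ↥(W.geomPrimaryTorsion p) v}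
    (hL : IsRamifiedOrdinaryLine W p L) (τ : absoluteGaloisGroup (v.adicCompletion ℚ)) :
    ∃ a : ℕ, ∀ m ∈ L.plus, p • m = 0 →
      absGaloisRestrict ℚ (v.adicCompletion ℚ) τ • m = a • m := by
  have hCp := natCard_plus_inf_torsionBy_eq hL
  set K : AddSubgroup ↥(W.geomPrimaryTorsion p) :=
    L.plus ⊓ (↥(W.geomPrimaryTorsion p))[(p : ℤ)] with hK
  haveI : Finite ↥K := Nat.finite_of_card_ne_zero (by rw [hCp]; exact hp.out.ne_zero)
  have hKne : K ≠ ⊥ := (AddSubgroup.one_lt_card_iff_ne_bot K).mp (by rw [hCp]; exact hp.out.one_lt)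
  obtain ⟨x₀, hx₀⟩ := (AddSubgroup.ne_bot_iff_exists_ne_zero).mp hKne
  have ht₀S : (x₀ : ↥(W.geomPrimaryTorsion p)) ∈ L.plus := (AddSubgroup.mem_inf.1 x₀.2).1
  have ht₀p : p • (x₀ : ↥(W.geomPrimaryTorsion p)) = 0 :=
    AddSubgroup.torsionBy.nsmul_iff.mp (AddSubgroup.mem_inf.1 x₀.2).2
  have ht₀ : (x₀ : ↥(W.geomPrimaryTorsion p)) ≠ 0 := fun h ↦ hx₀ (Subtype.ext h)
  set g := absGaloisRestrict ℚ (v.adicCompletion ℚ) τ with hg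
  have hcomm : ∀ (c : ℕ) (x : ↥(W.geomPrimaryTorsion p)), g • (c • x) = c • (g • x) := fun c x ↦
    map_nsmul (DistribSMul.toAddMonoidHom ↥(W.geomPrimaryTorsion p) g) c x
  -- `g • x₀ = a • x₀`
  obtain ⟨a, ha⟩ := exists_nsmul_eq_of_pTorsion_of_natCard p L.plus hCp ht₀S ht₀p ht₀
    (L.smul_mem τ ht₀S) (by rw [← hcomm, ht₀p, smul_zero])
  refine ⟨a, fun m hm hpm ↦ ?_⟩
  obtain ⟨j, rfl⟩ := exists_nsmul_eq_of_pTorsion_of_natCard p L.plus hCp ht₀S ht₀p ht₀ hm hpm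
  rw [hcomm, ha, ← mul_nsmul', ← mul_nsmul', mul_comm]

/-- **A generator of `(E[p^∞]/C)[p]`.** For a ramified ordinary line: some `x ∈ E[p^∞]` has image
`x̄ ≠ 0` in `E[p^∞]/C` killed by `p`, and every `p`-torsion element of `E[p^∞]/C` is a natural
multiple of `x̄` (`#(E[p^∞]/C)[p] = p`, the tree's `finite_and_natCard_torsionBy_gr`).
[cite: GreenbergVatsal2000, §2 p. 14] -/
theorem exists_quotGenerator {L : LocalDatum ℚ ↥(W.geomPrimaryTorsion p) v}
    (hL : IsRamifiedOrdinaryLine W p L) :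
    ∃ x : ↥(W.geomPrimaryTorsion p), L.grMk x ≠ 0 ∧ p • L.grMk x = 0 ∧
      ∀ d : L.Gr, p • d = 0 → ∃ i : ℕ, d = i • L.grMk x := by
  have hCp := natCard_plus_inf_torsionBy_eq hL
  have hDcard : Nat.card ↥((L.Gr)[(p : ℤ)]) = p :=
    (finite_and_natCard_torsionBy_gr W p L (fun _ hc ↦ hL.divisible hc) hCp).2
  have hDcard' : Nat.card ↥((⊤ : AddSubgroup L.Gr) ⊓ (L.Gr)[(p : ℤ)]) = p := by
    rw [top_inf_eq]; exact hDcard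
  haveI : Finite ↥((L.Gr)[(p : ℤ)]) := Nat.finite_of_card_ne_zero (by rw [hDcard]; exact hp.out.ne_zero)
  have hne : (L.Gr)[(p : ℤ)] ≠ ⊥ :=
    (AddSubgroup.one_lt_card_iff_ne_bot _).mp (by rw [hDcard]; exact hp.out.one_lt)
  obtain ⟨d₀, hd₀⟩ := (AddSubgroup.ne_bot_iff_exists_ne_zero).mp hne
  have hd₀p : p • (d₀ : L.Gr) = 0 := AddSubgroup.torsionBy.nsmul_iff.mp d₀.2
  have hd₀ne : (d₀ : L.Gr) ≠ 0 := fun h ↦ hd₀ (Subtype.ext h)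
  obtain ⟨x, hx⟩ := L.grMk_surjective (d₀ : L.Gr)
  refine ⟨x, by rw [hx]; exact hd₀ne, by rw [hx]; exact hd₀p, fun d hd ↦ ?_⟩
  rw [hx]
  exact exists_nsmul_eq_of_pTorsion_of_natCard p (⊤ : AddSubgroup L.Gr) hDcard'
    (AddSubgroup.mem_top _) hd₀p hd₀ne (AddSubgroup.mem_top d) hd

omit [W.IsElliptic] hp in
/-- **The quotient scalar.** For a ramified ordinary line, a quotient generator `x` (as in
`exists_quotGenerator`) and `τ ∈ Γ_{ℚ_v}`: there is a natural scalar `b` with `res τ · x̄ = b · x̄`,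
and then `res τ · y − b · y ∈ C` for EVERY `y ∈ E[p^∞]` killed by `p` (`ȳ` is a multiple of `x̄`).
[cite: GreenbergVatsal2000, §2 p. 26] -/
theorem exists_quotScalar {L : LocalDatum ℚ ↥(W.geomPrimaryTorsion p) v}
    (τ : absoluteGaloisGroup (v.adicCompletion ℚ))
    {x : ↥(W.geomPrimaryTorsion p)} (hxp : p • L.grMk x = 0)
    (hgen : ∀ d : L.Gr, p • d = 0 → ∃ i : ℕ, d = i • L.grMk x) :
    ∃ b : ℕ, L.grMk (absGaloisRestrict ℚ (v.adicCompletion ℚ) τ • x) = b • L.grMk x ∧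
      ∀ y : ↥(W.geomPrimaryTorsion p), p • y = 0 →
        absGaloisRestrict ℚ (v.adicCompletion ℚ) τ • y - b • y ∈ L.plus := by
  set g := absGaloisRestrict ℚ (v.adicCompletion ℚ) τ with hg
  have hcomm : ∀ (c : ℕ) (z : ↥(W.geomPrimaryTorsion p)), g • (c • z) = c • (g • z) := fun c z ↦
    map_nsmul (DistribSMul.toAddMonoidHom ↥(W.geomPrimaryTorsion p) g) c z
  -- `C` is `g`-stable, so `grMk (g • c) = 0` for `c ∈ C`
  have hgC : ∀ c ∈ L.plus, L.grMk (g • c) = 0 := fun c hc ↦ by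
    rw [← AddMonoidHom.mem_ker, L.ker_grMk]; exact L.smul_mem τ hc
  -- `p • x ∈ C`, hence `grMk (g • x)` is `p`-torsion: `= b • x̄`
  have hpx : p • x ∈ L.plus := by
    rw [← L.ker_grMk, AddMonoidHom.mem_ker, map_nsmul]; exact hxp
  obtain ⟨b, hb⟩ := hgen (L.grMk (g • x)) (by rw [← map_nsmul, ← hcomm]; exact hgC _ hpx)
  refine ⟨b, hb, fun y hy ↦ ?_⟩
  -- `ȳ = i • x̄`, so `y = i • x + c` with `c ∈ C`
  obtain ⟨i, hi⟩ := hgen (L.grMk y) (by rw [← map_nsmul, hy, map_zero])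
  have hc : y - i • x ∈ L.plus := by
    rw [← L.ker_grMk, AddMonoidHom.mem_ker, map_sub, map_nsmul, hi, sub_self]
  rw [← L.ker_grMk, AddMonoidHom.mem_ker, map_sub, map_nsmul]
  have hgy : g • y = i • (g • x) + g • (y - i • x) := by
    rw [smul_sub, hcomm, add_sub_cancel]
  rw [hgy, map_add, hgC _ hc, add_zero, map_nsmul, hb, hi, ← mul_nsmul', ← mul_nsmul', mul_comm,
    sub_self]

/-! ## §2. The relations `bⁿ ≡ 1` (clause 4) and `a·b ≡ χ_p(σ)` (Weil pairing) modulo `p` -/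

omit [W.IsElliptic] in
/-- **`bⁿ ≡ 1 (mod p)`**: if `(res τ)ⁿ` acts trivially on `E[p^∞]/C` and `res τ · x̄ = b · x̄` for the
quotient generator `x̄` (of order `p`), then `bⁿ = 1` in `ℤ/p`. [cite: GreenbergVatsal2000, §2 p. 26] -/
theorem quotScalar_pow_eq_one {L : LocalDatum ℚ ↥(W.geomPrimaryTorsion p) v}
    (τ : absoluteGaloisGroup (v.adicCompletion ℚ)) {n : ℕ}
    (hn : ∀ m : ↥(W.geomPrimaryTorsion p),
      (absGaloisRestrict ℚ (v.adicCompletion ℚ) τ) ^ n • m - m ∈ L.plus)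
    {x : ↥(W.geomPrimaryTorsion p)} (hx0 : L.grMk x ≠ 0) (hxp : p • L.grMk x = 0) {b : ℕ}
    (hb : L.grMk (absGaloisRestrict ℚ (v.adicCompletion ℚ) τ • x) = b • L.grMk x) :
    ((b : ZMod p)) ^ n = 1 := by
  set g := absGaloisRestrict ℚ (v.adicCompletion ℚ) τ with hg
  have hcomm : ∀ (c : ℕ) (z : ↥(W.geomPrimaryTorsion p)), g • (c • z) = c • (g • z) := fun c z ↦
    map_nsmul (DistribSMul.toAddMonoidHom ↥(W.geomPrimaryTorsion p) g) c z
  have hgC : ∀ c ∈ L.plus, L.grMk (g • c) = 0 := fun c hc ↦ by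
    rw [← AddMonoidHom.mem_ker, L.ker_grMk]; exact L.smul_mem τ hc
  -- `grMk (g^j • x) = b^j • x̄`
  have hpow : ∀ j : ℕ, L.grMk (g ^ j • x) = b ^ j • L.grMk x := by
    intro j
    induction j with
    | zero => rw [pow_zero, one_smul, pow_zero, one_nsmul]
    | succ j ih =>
      -- `g^j • x = b^j • x + c`, `c ∈ C`
      have hc : g ^ j • x - b ^ j • x ∈ L.plus := by
        rw [← L.ker_grMk, AddMonoidHom.mem_ker, map_sub, map_nsmul, ih, sub_self]
      have hstep : g ^ (j + 1) • x = b ^ j • (g • x) + g • (g ^ j • x - b ^ j • x) := by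
        rw [pow_succ', mul_smul, smul_sub, hcomm, add_sub_cancel]
      rw [hstep, map_add, hgC _ hc, add_zero, map_nsmul, hb, ← mul_nsmul', ← pow_succ]
  -- `(b^n - 1) • x̄ = 0` with `x̄` of order `p`
  have hord : addOrderOf (L.grMk x) = p := addOrderOf_eq_prime hxp hx0
  have hz : (((b ^ n : ℕ) : ℤ) - 1) • L.grMk x = 0 := by
    rw [sub_smul, natCast_zsmul, one_zsmul, ← hpow n]
    have h := hn x
    rw [← L.ker_grMk, AddMonoidHom.mem_ker, map_sub] at h
    exact h
  have hdvd : (p : ℤ) ∣ ((b ^ n : ℕ) : ℤ) - 1 := by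
    rw [← hord]; exact (addOrderOf_dvd_iff_zsmul_eq_zero).mpr hz
  have h0 : (((((b ^ n : ℕ) : ℤ) - 1 : ℤ)) : ZMod p) = 0 :=
    (ZMod.intCast_zmod_eq_zero_iff_dvd _ p).mpr hdvd
  rw [Int.cast_sub, Int.cast_one, sub_eq_zero, Int.cast_natCast, Nat.cast_pow] at h0
  exact h0

/-- **`a·b ≡ χ_p(σ) (mod p)` by the Weil pairing on `E`.** If `σ ∈ Γ_{ℚ_v}` acts on `C ∩ E[p^∞][p]`
as `a` and on `E[p^∞][p]` modulo `C` as `b`, then for some primitive `p`-th root of unity `ζ ∈ K̄_v`,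
`σζ = ζ^{b a}` (`det ρ̄_{E,p}(σ) = ω(σ)`: the tree's `localPoints_exists_isPrimitiveRoot_smul_eq_pow`
at level `k = 1`, transported along `ι : E[p^∞](ℚ̄) ↪ E(K̄_v)`). Silverman *AEC* III.8.1.
[cite: SilvermanAEC2009, Prop. III.8.1] [cite: GreenbergVatsal2000, §2 p. 26] -/
theorem exists_isPrimitiveRoot_smul_eq_pow_quotScalar_mul_lineScalar
    {L : LocalDatum ℚ ↥(W.geomPrimaryTorsion p) v} (hL : IsRamifiedOrdinaryLine W p L)
    (σ : absoluteGaloisGroup (v.adicCompletion ℚ)) {a b : ℕ}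
    (hline : ∀ m ∈ L.plus, p • m = 0 → absGaloisRestrict ℚ (v.adicCompletion ℚ) σ • m = a • m)
    (hquot : ∀ y : ↥(W.geomPrimaryTorsion p), p • y = 0 →
      absGaloisRestrict ℚ (v.adicCompletion ℚ) σ • y - b • y ∈ L.plus) :
    ∃ ζ : AlgebraicClosure (v.adicCompletion ℚ), IsPrimitiveRoot ζ (p ^ 1) ∧
      σ • ζ = ζ ^ (b * a) := by
  have hCp := natCard_plus_inf_torsionBy_eq hL
  -- `p ≠ 0` in `ℚ_v`
  haveI : NeZero ((p : ℕ) : v.adicCompletion ℚ) := ⟨by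
    rw [← map_natCast (algebraMap ℚ (v.adicCompletion ℚ))]
    exact (map_ne_zero_iff _ (algebraMap ℚ (v.adicCompletion ℚ)).injective).mpr
      (Nat.cast_ne_zero.mpr hp.out.ne_zero)⟩
  -- a non-zero `p`-torsion element `t₀ ∈ C`
  set K : AddSubgroup ↥(W.geomPrimaryTorsion p) :=
    L.plus ⊓ (↥(W.geomPrimaryTorsion p))[(p : ℤ)] with hK
  haveI : Finite ↥K := Nat.finite_of_card_ne_zero (by rw [hCp]; exact hp.out.ne_zero)
  have hKne : K ≠ ⊥ := (AddSubgroup.one_lt_card_iff_ne_bot K).mp (by rw [hCp]; exact hp.out.one_lt)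
  obtain ⟨x₀, hx₀⟩ := (AddSubgroup.ne_bot_iff_exists_ne_zero).mp hKne
  have ht₀S : (x₀ : ↥(W.geomPrimaryTorsion p)) ∈ L.plus := (AddSubgroup.mem_inf.1 x₀.2).1
  have ht₀p : p • (x₀ : ↥(W.geomPrimaryTorsion p)) = 0 :=
    AddSubgroup.torsionBy.nsmul_iff.mp (AddSubgroup.mem_inf.1 x₀.2).2
  have ht₀ : (x₀ : ↥(W.geomPrimaryTorsion p)) ≠ 0 := fun h ↦ hx₀ (Subtype.ext h)
  set t₀ : ↥(W.geomPrimaryTorsion p) := x₀.1 with ht₀def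
  -- transport to `E(K̄_v)`
  set ι : ↥(W.geomPrimaryTorsion p) →+ localPoints W (v.adicCompletion ℚ) :=
    (pointsMap W (v.adicCompletion ℚ)).comp (W.geomPrimaryTorsion p).subtype with hιdef
  have hι : ∀ x : ↥(W.geomPrimaryTorsion p),
      ι x = pointsMap W (v.adicCompletion ℚ) (x : W.geomPoints) := fun _ ↦ rfl
  have hιinj : Function.Injective ι := fun x y h ↦
    pointsMap_coe_injective W p (v := v) (by simpa only [hι] using h)
  have hισ : ∀ x : ↥(W.geomPrimaryTorsion p),
      ι (absGaloisRestrict ℚ (v.adicCompletion ℚ) σ • x) = σ • ι x := by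
    intro x
    rw [hι, hι, primaryComponent.coe_smul, pointsMap_absGaloisRestrict_smul]
  have hcomm : ∀ (c : ℕ) (x : ↥(W.geomPrimaryTorsion p)),
      absGaloisRestrict ℚ (v.adicCompletion ℚ) σ • (c • x) =
        c • (absGaloisRestrict ℚ (v.adicCompletion ℚ) σ • x) := fun c x ↦
    map_nsmul (DistribSMul.toAddMonoidHom ↥(W.geomPrimaryTorsion p)
      (absGaloisRestrict ℚ (v.adicCompletion ℚ) σ)) c x
  set P₀ : localPoints W (v.adicCompletion ℚ) := ι t₀ with hP₀
  have ht₀ord : addOrderOf t₀ = p ^ 1 := by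
    rw [pow_one]; exact addOrderOf_eq_prime ht₀p ht₀
  have hP₀ord : addOrderOf P₀ = p ^ 1 := by rw [hP₀, addOrderOf_injective ι hιinj, ht₀ord]
  -- (h1) `σ P₀ = a P₀`
  have h1 : ∀ τ ∈ ({σ} : Set (absoluteGaloisGroup (v.adicCompletion ℚ))), τ • P₀ = a • P₀ := by
    intro τ hτ
    rw [Set.mem_singleton_iff.mp hτ, hP₀, ← hισ, hline t₀ ht₀S ht₀p, map_nsmul]
  -- (h2) `σ Q - b Q` is a multiple of `P₀` for every `p`-torsion `Q`
  have h2 : ∀ τ ∈ ({σ} : Set (absoluteGaloisGroup (v.adicCompletion ℚ))),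
      ∀ Q : localPoints W (v.adicCompletion ℚ), ((p ^ 1 : ℕ) : ℤ) • Q = 0 →
        ∃ d : ℕ, τ • Q - (fun _ ↦ b) τ • Q = d • P₀ := by
    intro τ hτ Q hQ
    rw [Set.mem_singleton_iff.mp hτ]
    rw [natCast_zsmul] at hQ
    obtain ⟨m', hm'⟩ := exists_primaryTorsion_pointsMap_eq W p Q 1 hQ
    rw [pow_one] at hQ
    have hm'p : p • m' = 0 := hιinj (by rw [map_nsmul, hι, hm', hQ, map_zero])
    have hdiff := hquot m' hm'p
    have hdiffp : p • (absGaloisRestrict ℚ (v.adicCompletion ℚ) σ • m' - b • m') = 0 := by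
      rw [nsmul_sub, ← hcomm, hm'p, smul_zero, smul_comm, hm'p, smul_zero, sub_self]
    obtain ⟨d, hd⟩ := exists_nsmul_eq_of_pTorsion_of_natCard p L.plus hCp ht₀S ht₀p ht₀ hdiff hdiffp
    refine ⟨d, ?_⟩
    rw [← hm', ← hι m', ← hισ, ← map_nsmul ι b, ← map_sub, hd, map_nsmul]
  obtain ⟨ζ, hζ, hζσ⟩ := @WeierstrassCurve.localPoints_exists_isPrimitiveRoot_smul_eq_pow ℚ _ W _
    (v.adicCompletion ℚ) _ _
    (charZero_of_injective_algebraMap (algebraMap ℚ (v.adicCompletion ℚ)).injective) p _ 1 P₀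
    hP₀ord ({σ} : Set (absoluteGaloisGroup (v.adicCompletion ℚ))) (fun _ ↦ a) (fun _ ↦ b) h1 h2
  exact ⟨ζ, hζ, hζσ σ (Set.mem_singleton σ)⟩

/-- **`a·b = χ_p(σ)` in `ℤ/p`** for `σ ∈ Γ_{ℚ_v}` with `χ_p(σ) = N ∈ ℕ` (as a `p`-adic integer),
line scalar `a` and quotient scalar `b`: the Weil-pairing root `ζ` of the previous lemma has
`σζ = ζ^{ba}` and `σζ = ζ^{χ_p(σ)}` (`cyclotomicCharacter_spec`).
[cite: SilvermanAEC2009, Prop. III.8.1] [cite: SerreLocalFields1979, Ch. IV §4 Prop. 17] -/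
theorem quotScalar_mul_lineScalar_eq_of_cyclotomicCharacter_eq
    {L : LocalDatum ℚ ↥(W.geomPrimaryTorsion p) v} (hL : IsRamifiedOrdinaryLine W p L)
    {σ : absoluteGaloisGroup (v.adicCompletion ℚ)} {N : ℕ}
    (hχ : ((GaloisRep.cyclotomicCharacter (v.adicCompletion ℚ) p σ : ℤ_[p]ˣ) : ℤ_[p]) = N)
    {a b : ℕ}
    (hline : ∀ m ∈ L.plus, p • m = 0 → absGaloisRestrict ℚ (v.adicCompletion ℚ) σ • m = a • m)
    (hquot : ∀ y : ↥(W.geomPrimaryTorsion p), p • y = 0 →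
      absGaloisRestrict ℚ (v.adicCompletion ℚ) σ • y - b • y ∈ L.plus) :
    ((b : ZMod p)) * (a : ZMod p) = (N : ZMod p) := by
  haveI : NeZero ((p : ℕ) : v.adicCompletion ℚ) := ⟨by
    rw [← map_natCast (algebraMap ℚ (v.adicCompletion ℚ))]
    exact (map_ne_zero_iff _ (algebraMap ℚ (v.adicCompletion ℚ)).injective).mpr
      (Nat.cast_ne_zero.mpr hp.out.ne_zero)⟩
  obtain ⟨ζ, hζ, hζσ⟩ :=
    exists_isPrimitiveRoot_smul_eq_pow_quotScalar_mul_lineScalar hL σ hline hquot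
  have hχ1 : ((GaloisRep.cyclotomicCharacter (v.adicCompletion ℚ) p σ).val.toZModPow 1).val =
      N % p ^ 1 := by
    rw [hχ, map_natCast, ZMod.val_natCast]
  have hσζ : σ • ζ = ζ ^ (N % p ^ 1) := by
    rw [← hχ1]
    exact GaloisRep.cyclotomicCharacter_spec (v.adicCompletion ℚ) p σ ζ hζ.pow_eq_one
  have hcmp : ζ ^ ((b * a) % p ^ 1) = ζ ^ (N % p ^ 1) := by
    rw [← hσζ, hζσ, hζ.eq_orderOf, pow_mod_orderOf]
  have hmod : (b * a) % p ^ 1 = N % p ^ 1 :=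
    hζ.pow_inj (Nat.mod_lt _ (pow_pos hp.out.pos 1)) (Nat.mod_lt _ (pow_pos hp.out.pos 1)) hcmp
  rw [pow_one] at hmod
  have h := (ZMod.natCast_eq_natCast_iff' (b * a) N p).mpr hmod
  rwa [Nat.cast_mul] at h

/-! ## §3. A primitive root in the local inertia group, and the scalar separation -/

/-- **A local inertia element with `χ_p(σ) ≡ g₀`, `g₀` a primitive root mod `p`.** (`(ℤ/p)ˣ` is
cyclic; local Kronecker–Weber `χ_p(I_{ℚ_v}) = ℤ_pˣ`, tree
`exists_mem_absInertia_cyclotomicCharacter_eq_natCast`.) [cite: SerreLocalFields1979, Ch. IV §4 Prop. 17] -/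
theorem exists_mem_absInertia_cyclotomicCharacter_primitiveRoot
    (hpv : ((p : ℕ) : 𝓞 ℚ) ∈ v.asIdeal) :
    ∃ σ ∈ absInertia (v.adicCompletion ℚ), ∃ g₀ : ℕ,
      ((GaloisRep.cyclotomicCharacter (v.adicCompletion ℚ) p σ : ℤ_[p]ˣ) : ℤ_[p]) = g₀ ∧
      ∃ u : (ZMod p)ˣ, (u : ZMod p) = g₀ ∧ orderOf u = p - 1 := by
  obtain ⟨u, hu⟩ := IsCyclic.exists_generator (α := (ZMod p)ˣ)
  have hord : orderOf u = p - 1 := by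
    rw [orderOf_eq_card_of_forall_mem_zpowers hu, Nat.card_eq_fintype_card, ZMod.card_units]
  set g₀ : ℕ := (u : ZMod p).val with hg₀
  have hg₀u : ((g₀ : ℕ) : ZMod p) = (u : ZMod p) := by rw [hg₀, ZMod.natCast_zmod_val]
  have hg₀p : ¬ p ∣ g₀ := by
    intro h
    have h0 : ((g₀ : ℕ) : ZMod p) = 0 := (ZMod.natCast_eq_zero_iff g₀ p).mpr h
    rw [hg₀u] at h0
    exact u.ne_zero h0
  obtain ⟨σ, hσ, hχ⟩ := exists_mem_absInertia_cyclotomicCharacter_eq_natCast p hpv hg₀p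
  exact ⟨σ, hσ, g₀, hχ, u, hg₀u.symm, hord⟩

/-- **Scalar separation off the swap locus.** In `ℤ/p`: if `a b = g₀ = a₁ b₁` with `g₀` of
multiplicative order `p − 1`, `bⁿ = 1`, `b₁^{n₁} = 1` and `(p − 1) ∤ lcm(n, n₁)`, then `a ≠ b₁`
(else `g₀^{lcm} = b₁^{lcm} b^{lcm} = 1`). Pure arithmetic. [folklore] -/
theorem lineScalar_ne_quotScalar {a b b₁ : ZMod p} {u : (ZMod p)ˣ} {n n₁ : ℕ}
    (hab : b * a = (u : ZMod p)) (hu : orderOf u = p - 1)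
    (hbn : b ^ n = 1) (hb₁n : b₁ ^ n₁ = 1) (hlcm : ¬ (p - 1) ∣ Nat.lcm n n₁) : a ≠ b₁ := by
  intro h
  apply hlcm
  rw [← hu, orderOf_dvd_iff_pow_eq_one]
  apply Units.ext
  obtain ⟨k, hk⟩ := Nat.dvd_lcm_left n n₁
  obtain ⟨k₁, hk₁⟩ := Nat.dvd_lcm_right n n₁
  have h1 : b ^ Nat.lcm n n₁ = 1 := by rw [hk, pow_mul, hbn, one_pow]
  have h2 : b₁ ^ Nat.lcm n n₁ = 1 := by
    conv_lhs => rw [hk₁]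
    rw [pow_mul, hb₁n, one_pow]
  rw [Units.val_pow_eq_pow_val, ← hab, h, Units.val_one, mul_pow, h1, h2, mul_one]

end Summit.BirchSwinnertonDyer.Rank1Residual.Additive.RamifiedOrdinaryLineInertiaScalars

end
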